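import Summits.Ventures.Crystal3D.Theorems.StickyWulffConstantTextureBuildTentCover
import Summits.Ventures.Crystal3D.Theorems.StickyWulffConstantTextureBuildWulffSupportFrames
import Summits.Ventures.Crystal3D.Theorems.StickyWulffConstantTextureBuildCoverPieces
import Summits.Ventures.Crystal3D.Theorems.StickyWulffConstantTextureLiminfTexShadowBilayerFrameAxis
import HarnessLib

/-!
# TB-D assembly, part 12: the CERTIFIED TENT of a tent piece — canonical slab frames and the chosen output of `BarlowFreeCertificateCover`
# (lane T, crux `TextureLiminfV5`, stmt-Ventures-23912; blueprint HOME/wulff-p2/g20/TB-D-2-g20.md §1 (1a)(1c), lemma (L-T))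

HONEST FRAMING. Venture `Summits/Ventures/Crystal3D` (cell `crystal3d-full`), route `route-Ventures-StickyWulffConstant`, helper `--supports` the
law-v5 crux `TextureLiminfV5` (stmt-Ventures-23912).  DEFINITIONS by choice (census-free, standard axioms) + their specification lemmas.  The
certificate with cover (T0, `BarlowFreeCertificateCover`, …TextureBuildTentCover) is taken as a HYPOTHESIS `hT0` (its `_holds` is 23912-p1's brick);
nothing is proved about it here; F-C1 not moved.

* `canFrame` — ONE canonical frame function on bilayer point sets (choice from `exists_canonicalFrame`, …WulffSupportFrames p711720); `TentPiece.frame T i :=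
  canFrame (bilayer T.L T.s T.σ i)` — the frame of slab grain `(T, i)` of the texture; `TentPiece.frame_spec` (it frames the bilayer), `TentPiece.framesAt`.
* `TentCert T` — the certificate's output for the tent piece `T` framed canonically: the solid `G`, its pieces `H j` with slab indices `slabOf j`, and the
  seven clauses (near the atoms, bounded/unit/distinct/disjoint/in-slab pieces, layer-plane cover, mass, slab-wise perimeter); `tentCert hT0 T` — a choice.
* Consequences for the ledger: `TentCert.tsum_perKIn_ne_top`, `TentCert.perKIn_ne_top` (the `hVfin` input of `free_le_split`), **`TentCert.tsum_perKIn_le_budget`**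
  (`(Σ' i, perKIn (W_i) G (U ∩ slab_i)).toReal ≤ T.budget` — the `T ≤ tentBudget` input, per piece).
-/

noncomputable section

open scoped BigOperators InnerProductSpace ENNReal
open MeasureTheory

namespace Summit.Ventures.Crystal3D.Cruxes.TextureLiminf.TexShadow

open Summit.Ventures.Crystal3D Summit.Ventures.Crystal3D.Theorems Summit.Ventures.Crystal3D.TentCertificate
open Literature.MathematicalPhysics.StatisticalMechanics (IsHaggSeq HasFinitePerimeter)

/-! ### Canonical frames -/

/-- ONE canonical frame function on point sets (every bilayer of every moved Barlow stacking lies on `canFrame B · fccRef + u`). -/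
def canFrame : Set E3 → (E3 ≃ₗᵢ[ℝ] E3) := Classical.choose exists_canonicalFrame

/-- The canonical frame frames every bilayer. -/
theorem canFrame_spec {σ : ℤ → ℤ} (hσ : IsHaggSeq σ) (L : E3 ≃ₗᵢ[ℝ] E3) (s : E3) (i : ℤ) :
    ∃ u : E3, bilayer L s σ i ⊆ (fun r => canFrame (bilayer L s σ i) r + u) '' fccRef :=
  Classical.choose_spec exists_canonicalFrame σ hσ L s i

namespace TentPiece

/-- the canonical frame of slab grain `(T, i)`: depends only on the bilayer POINT SET -/
def frame (T : TentPiece) (i : ℤ) : E3 ≃ₗᵢ[ℝ] E3 := canFrame (bilayer T.L T.s T.σ i)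

/-- The canonical frame frames the bilayer. -/
theorem frame_spec (T : TentPiece) (i : ℤ) : ∃ u : E3, bilayer T.L T.s T.σ i ⊆ (fun r => T.frame i r + u) '' fccRef :=
  canFrame_spec T.hσ T.L T.s i

/-- Equal bilayer point sets have equal canonical frames (hence equal lattices: a `c = 0` pair in the law). -/
theorem frame_congr {T T' : TentPiece} {i i' : ℤ} (h : bilayer T.L T.s T.σ i = bilayer T'.L T'.s T'.σ i') : T.frame i = T'.frame i' := by
  unfold frame; rw [h]

/-- The canonical frames with their origins form a `BilayerFramesAt` family. -/
theorem framesAt (T : TentPiece) : BilayerFramesAt T.L T.s T.σ T.frame (fun i => Classical.choose (T.frame_spec i)) :=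
  fun i => Classical.choose_spec (T.frame_spec i)

/-- Any two slab grains of ONE tent piece share the stacking axis `T.L e₃`. -/
theorem sharedAxis_frame (T : TentPiece) (i i' : ℤ) : SharedAxis (T.L e₃) (T.frame i) (T.frame i') :=
  sharedAxis_bilayerFrames_of_frame T.hσ T.hσ T.framesAt T.framesAt i i'

end TentPiece

/-! ### The certified tent -/

/-- **The certificate's output for a tent piece, framed canonically** (the data and clauses of `BarlowFreeCertificateCover` at
`(T.σ, T.L, T.s, T.frame, T.Xh, T.U)`). -/
structure TentCert (T : TentPiece) where
  /-- the tent solid -/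
  G : Set E3
  /-- its pieces and their slab indices -/
  J : ℕ
  H : Fin J → Finset (E3 × ℝ)
  slabOf : Fin J → ℤ
  hfin : HasFinitePerimeter G
  hvol : volume G < ⊤
  hnear : G ⊆ ⋃ a ∈ T.Xh, Metric.closedBall a (Real.sqrt 2)
  hbd : ∀ j, Bornology.IsBounded (polytope (H j))
  hunit : ∀ j, ∀ p ∈ H j, ‖p.1‖ = 1
  hplanes : ∀ j, ∀ p ∈ H j, ∀ p' ∈ H j, p ≠ p' → {x : E3 | ⟪p.1, x⟫_ℝ = p.2} ≠ {x : E3 | ⟪p'.1, x⟫_ℝ = p'.2}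
  hdisj : ∀ j j', j ≠ j' → Disjoint (polytope (H j)) (polytope (H j'))
  hslab : ∀ j, polytope (H j) ⊆ laySlab T.L T.s (slabOf j)
  hG : G = ⋃ j, polytope (H j)
  hcover : LayerPlaneCover T.L T.s J H slabOf
  hmass : volume ({y : E3 | ∀ b ∈ stacking T.L T.s T.σ, dist y b ≤ Real.sqrt 2 → b ∈ T.Xh} \ G) = 0
  hper : 2 * (∑' i : ℤ, perKIn (wulffOf (T.frame i)) G (T.U ∩ laySlab T.L T.s i)) ≤ (brokenNearIn (stacking T.L T.s T.σ) T.Xh T.U : ℝ≥0∞)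

/-- **A certified tent for every tent piece**, chosen from `BarlowFreeCertificateCover`. -/
def tentCert (hT0 : BarlowFreeCertificateCover) (T : TentPiece) : TentCert T := by
  have h := hT0 T.σ T.hσ T.L T.s T.frame T.frame_spec T.Xh T.hXh T.U T.hU
  refine
    { G := Classical.choose h
      J := Classical.choose (Classical.choose_spec h).2.2.2.1
      H := Classical.choose (Classical.choose_spec (Classical.choose_spec h).2.2.2.1)
      slabOf := Classical.choose (Classical.choose_spec (Classical.choose_spec (Classical.choose_spec h).2.2.2.1))
      hfin := (Classical.choose_spec h).1
      hvol := (Classical.choose_spec h).2.1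
      hnear := (Classical.choose_spec h).2.2.1
      hbd := (Classical.choose_spec (Classical.choose_spec (Classical.choose_spec (Classical.choose_spec h).2.2.2.1))).1
      hunit := (Classical.choose_spec (Classical.choose_spec (Classical.choose_spec (Classical.choose_spec h).2.2.2.1))).2.1
      hplanes := (Classical.choose_spec (Classical.choose_spec (Classical.choose_spec (Classical.choose_spec h).2.2.2.1))).2.2.1
      hdisj := (Classical.choose_spec (Classical.choose_spec (Classical.choose_spec (Classical.choose_spec h).2.2.2.1))).2.2.2.1
      hslab := (Classical.choose_spec (Classical.choose_spec (Classical.choose_spec (Classical.choose_spec h).2.2.2.1))).2.2.2.2.1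
      hG := (Classical.choose_spec (Classical.choose_spec (Classical.choose_spec (Classical.choose_spec h).2.2.2.1))).2.2.2.2.2.1
      hcover := (Classical.choose_spec (Classical.choose_spec (Classical.choose_spec (Classical.choose_spec h).2.2.2.1))).2.2.2.2.2.2
      hmass := (Classical.choose_spec h).2.2.2.2.1
      hper := (Classical.choose_spec h).2.2.2.2.2 }

namespace TentCert

variable {T : TentPiece}

/-- The slab-wise perimeter sum is finite. -/
theorem tsum_perKIn_ne_top (ct : TentCert T) : (∑' i : ℤ, perKIn (wulffOf (T.frame i)) ct.G (T.U ∩ laySlab T.L T.s i)) ≠ ⊤ := by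
  have h := ct.hper
  have h1 : (∑' i : ℤ, perKIn (wulffOf (T.frame i)) ct.G (T.U ∩ laySlab T.L T.s i)) ≤
      2 * (∑' i : ℤ, perKIn (wulffOf (T.frame i)) ct.G (T.U ∩ laySlab T.L T.s i)) := by
    calc (∑' i : ℤ, perKIn (wulffOf (T.frame i)) ct.G (T.U ∩ laySlab T.L T.s i))
        = 1 * (∑' i : ℤ, perKIn (wulffOf (T.frame i)) ct.G (T.U ∩ laySlab T.L T.s i)) := (one_mul _).symm
      _ ≤ 2 * (∑' i : ℤ, perKIn (wulffOf (T.frame i)) ct.G (T.U ∩ laySlab T.L T.s i)) := by gcongr; norm_num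
  exact ne_top_of_le_ne_top (ENNReal.natCast_ne_top _) (h1.trans h)

/-- Each slab's localized perimeter is finite (the `hVfin` input of `free_le_split`). -/
theorem perKIn_ne_top (ct : TentCert T) (i : ℤ) : perKIn (wulffOf (T.frame i)) ct.G (T.U ∩ laySlab T.L T.s i) ≠ ⊤ :=
  ne_top_of_le_ne_top ct.tsum_perKIn_ne_top (ENNReal.le_tsum i)

/-- **The tent budget pays the slab-wise perimeters**: `(Σ' i, perKIn (W_i) G (U ∩ slab_i)).toReal ≤ T.budget`. -/
theorem tsum_perKIn_le_budget (ct : TentCert T) :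
    (∑' i : ℤ, perKIn (wulffOf (T.frame i)) ct.G (T.U ∩ laySlab T.L T.s i)).toReal ≤ T.budget := by
  unfold TentPiece.budget
  have h := ct.hper
  have hfin := ct.tsum_perKIn_ne_top
  have h2 : ((∑' i : ℤ, perKIn (wulffOf (T.frame i)) ct.G (T.U ∩ laySlab T.L T.s i)).toReal) * 2 ≤
      (brokenNearIn (stacking T.L T.s T.σ) T.Xh T.U : ℝ) := by
    have := ENNReal.toReal_mono (ENNReal.natCast_ne_top _) h
    rw [ENNReal.toReal_mul, ENNReal.toReal_natCast] at this
    simpa [mul_comm] using this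
  linarith

/-- A finite partial sum of the slab-wise perimeters is at most the budget. -/
theorem sum_perKIn_le_budget (ct : TentCert T) (I : Finset ℤ) :
    ∑ i ∈ I, (perKIn (wulffOf (T.frame i)) ct.G (T.U ∩ laySlab T.L T.s i)).toReal ≤ T.budget := by
  refine le_trans ?_ ct.tsum_perKIn_le_budget
  rw [← ENNReal.toReal_sum (fun i _ => ct.perKIn_ne_top i)]
  exact ENNReal.toReal_mono ct.tsum_perKIn_ne_top (ENNReal.sum_le_tsum I)

/-- The tent solid is a finite union of its pieces (re-export of `hG` as a membership statement). -/
theorem mem_G_iff (ct : TentCert T) (y : E3) : y ∈ ct.G ↔ ∃ j, y ∈ polytope (ct.H j) := by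
  rw [ct.hG, Set.mem_iUnion]

/-- An `EmptyAt`-style point (farther than `√2` from every tent atom) is not in the closure of the tent solid. -/
theorem not_mem_closure_G (ct : TentCert T) {y : E3} (hy : ∀ a ∈ T.Xh, Real.sqrt 2 < dist y a) : y ∉ closure ct.G := by
  have hcl : IsClosed (⋃ a ∈ T.Xh, Metric.closedBall a (Real.sqrt 2)) :=
    isClosed_biUnion_finset fun _ _ => Metric.isClosed_closedBall
  intro h
  obtain ⟨a, ha, hya⟩ := Set.mem_iUnion₂.1 ((closure_minimal ct.hnear hcl) h)
  rw [Metric.mem_closedBall] at hya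
  linarith [hy a ha]

end TentCert

end Summit.Ventures.Crystal3D.Cruxes.TextureLiminf.TexShadow

end
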